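import Mathlib
import Literature.Analysis.FluidPDE.FluidComputer.RotationalForm
import Literature.Analysis.FluidPDE.FluidComputer.ScaleByScaleBudget

/-!
# FLUX IS LAMB WORK — part A `LambWork` of the Galerkin-exact core of the Lamb-efficiency ledger
(pub-fluidc cell, rung R2, CARD O7 §5)

HONEST FRAMING (cell `pub-fluidc`, verbatim): *low prior, high value-of-information experiment on
Tao's machine paradigm; NOT a claim that NS blows up.*

Mathematics and Lean by seat idea-2 gen 6 (`HOME/pub-fluidc-idea-2/SKETCH-R2-lamb-galerkin.lean`, sha16
97789fb5c3bf72e2, 659 lines, CARD O7 §5); split into three tree files (≤ 400 lines each, one namespace,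
declaration names unchanged) and landed by seat p2 gen 2: `LambWork` (§§0–3: flux is Lamb work,
Cauchy–Schwarz efficiency ≤ 1, Frisch (2.48) with Lamb work), `LambGridBessel` (§4a: grid characters,
Bessel, Parseval — independent of `LambWork`), `LambCertified` (§4b–§5: Hermitian Lagrange identity, the
certified column `abs_shellTransfer_le_certified`, the clock corollary; imports both).

This file (§§0–3), over the tree's typed objects (`ShellTransfer.FourierVelocity`, `shellTransfer`,
`ShellTransfer.rotational` of `RotationalForm`, `IsGalerkinSolution` / `hasDerivAt_outsideEnergy_galerkin` of
`ScaleByScaleBudget`), for a coefficient field supported in a disjoint split `S = I ∪ O`: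

* `re_cdot_rotational_eq_energyRate` — mode by mode, `Re( conj û(k) · (u×ω)^_S(k) ) = energyRate û S k`:
  the Bernoulli gradient does no work on a divergence-free mode (`rotational_eq` +
  `cdot_conj_coeff_parallel`);
* **`shellTransfer_eq_lambWork`** — `Π = T(I→O) = Σ_{k∈O} Re( conj û(k) · (u×ω)^_S(k) )`: the energy
  flux into the out-band IS the work of the truncated Lamb vector on the out-band velocity;
* **`abs_shellTransfer_le_lamb`** — Cauchy–Schwarz in `ℂ³` and over `k ∈ O`:
  `|Π| ≤ √(2 E_O) · √(L_O)`, `L_O = Σ_{k∈O} ‖(u×ω)^_S(k)‖²` (the out-band Lamb energy, i.e. the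
  column `lamb_hp_l2[K]²` CARD-O7 §4 asks GRID to certify), hence
  **`galerkinLambEfficiency_le_one`**: `e_geom := |Π| / (√(2E_O) √L_O) ≤ 1`;
* `hasDerivAt_outsideEnergy_lambWork` — Frisch (2.48) on the truncation with the flux written as
  Lamb work: `dE_O/dt = -2ν Z_O + Σ_{k∈O} Re(conj û · (u×ω)^_S) + ε_in,O`.

Helper definitions (support arithmetic, no physics): `sqNorm` (Hermitian `Σ_j ‖a_j‖²` on `ℂ³`), `work`, `sqNormOn`,
`galerkinLambEfficiency`. 0 sorry; Mathlib + the tree's `RotationalForm` / `ScaleByScaleBudget` only.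
-/


noncomputable section

open Complex ComplexConjugate Finset
open scoped BigOperators
open Literature.Analysis.FluidPDE.FluidComputer
open Literature.Analysis.FluidPDE.FluidComputer.ShellTransfer

namespace Summit.NavierStokesRegularity.FluidComputer.LambCeiling.Galerkin

variable (U : FourierVelocity)

/-- Squared Hermitian norm `Σ_j ‖a_j‖²` of a vector of `ℂ³`. [folklore] -/
def sqNorm (a : Fin 3 → ℂ) : ℝ := ∑ j, ‖a j‖ ^ 2

/-- `0 ≤ sqNorm a`. [folklore] -/
theorem sqNorm_nonneg (a : Fin 3 → ℂ) : 0 ≤ sqNorm a :=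
  Finset.sum_nonneg fun _ _ => by positivity

/-- `Σ_j ‖û_j(k)‖² = 2 E(k)`. -/
theorem sqNorm_coeff (k : Fin 3 → ℤ) : sqNorm (U.coeff k) = 2 * modalEnergy U k := by
  unfold sqNorm modalEnergy
  simp_rw [Complex.normSq_eq_norm_sq]
  ring

/-- The WORK of a coefficient family `R` on the modes of `O`: `Σ_{k∈O} Re( conj û(k) · R(k) )`. -/
def work (R : (Fin 3 → ℤ) → Fin 3 → ℂ) (O : Finset (Fin 3 → ℤ)) : ℝ :=
  ∑ k ∈ O, (cdot (fun j => conj (U.coeff k j)) (R k)).re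

/-- `Σ_{k∈O} Σ_j ‖R(k)_j‖²` — with `R = (u×ω)^_S` the out-band Lamb energy `L_O`. -/
def sqNormOn (R : (Fin 3 → ℤ) → Fin 3 → ℂ) (O : Finset (Fin 3 → ℤ)) : ℝ :=
  ∑ k ∈ O, sqNorm (R k)

/-- `0 ≤ sqNormOn R O`. [folklore] -/
theorem sqNormOn_nonneg (R : (Fin 3 → ℤ) → Fin 3 → ℂ) (O : Finset (Fin 3 → ℤ)) : 0 ≤ sqNormOn R O :=
  Finset.sum_nonneg fun _ _ => sqNorm_nonneg _

/-! ## 1. The Bernoulli gradient does no work: flux is Lamb work -/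

/-- Mode by mode, for `û` supported in `S`: `Re( conj û(k) · (u×ω)^_S(k) ) = energyRate û S k`. -/
theorem re_cdot_rotational_eq_energyRate (S : Finset (Fin 3 → ℤ)) (hU : ∀ p ∉ S, U.coeff p = 0)
    (k : Fin 3 → ℤ) :
    (cdot (fun j => conj (U.coeff k j)) (rotational U S k)).re = energyRate U S k := by
  have e : rotational U S k = fun j => advection U S k j + gradPart U S k * ((k j : ℤ) : ℂ) :=
    funext fun j => rotational_eq U S hU k j
  have hsplit : cdot (fun j => conj (U.coeff k j)) (rotational U S k) =
      cdot (fun j => conj (U.coeff k j)) (advection U S k) +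
        cdot (fun j => conj (U.coeff k j)) (fun j => gradPart U S k * ((k j : ℤ) : ℂ)) := by
    rw [e]
    unfold cdot
    rw [← Finset.sum_add_distrib]
    exact Finset.sum_congr rfl fun j _ => by ring
  rw [hsplit, cdot_conj_coeff_parallel, add_zero, energyRate_eq_re_cdot_advection]

/-- **FLUX IS LAMB WORK.** For a disjoint split `S = I ∪ O` and `û` supported in `S`:
`T(I→O) = Σ_{k∈O} Re( conj û(k) · (u×ω)^_S(k) )`. -/
theorem shellTransfer_eq_lambWork (I O : Finset (Fin 3 → ℤ)) (h : Disjoint I O)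
    (hU : ∀ p ∉ I ∪ O, U.coeff p = 0) :
    shellTransfer U O I = work U (rotational U (I ∪ O)) O := by
  rw [← outside_energyRate_eq_shellTransfer U I O h]
  unfold work
  exact Finset.sum_congr rfl fun k _ => (re_cdot_rotational_eq_energyRate U (I ∪ O) hU k).symm

/-! ## 2. Cauchy–Schwarz: the geometric Lamb efficiency is at most one -/

/-- Schwarz in `ℂ³`: `|Re(conj a · b)| ≤ √(Σ‖a_j‖²) √(Σ‖b_j‖²)`. [folklore] -/
theorem abs_re_cdot_conj_le (a b : Fin 3 → ℂ) :
    |(cdot (fun j => conj (a j)) b).re| ≤ Real.sqrt (sqNorm a) * Real.sqrt (sqNorm b) := by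
  unfold cdot sqNorm
  calc |(∑ j, conj (a j) * b j).re| ≤ ‖∑ j, conj (a j) * b j‖ := Complex.abs_re_le_norm _
    _ ≤ ∑ j, ‖conj (a j) * b j‖ := norm_sum_le _ _
    _ = ∑ j, ‖a j‖ * ‖b j‖ := Finset.sum_congr rfl fun j _ => by rw [norm_mul, Complex.norm_conj]
    _ ≤ Real.sqrt (∑ j, ‖a j‖ ^ 2) * Real.sqrt (∑ j, ‖b j‖ ^ 2) := Real.sum_mul_le_sqrt_mul_sqrt _ _ _

/-- **Work bound**: `|Σ_{k∈O} Re(conj û(k) · R(k))| ≤ √(2 E_O) · √(Σ_{k∈O} ‖R(k)‖²)` for ANY family `R`. -/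
theorem abs_work_le (R : (Fin 3 → ℤ) → Fin 3 → ℂ) (O : Finset (Fin 3 → ℤ)) :
    |work U R O| ≤ Real.sqrt (2 * truncEnergy U O) * Real.sqrt (sqNormOn R O) := by
  unfold work
  have h1 : |∑ k ∈ O, (cdot (fun j => conj (U.coeff k j)) (R k)).re| ≤
      ∑ k ∈ O, Real.sqrt (sqNorm (U.coeff k)) * Real.sqrt (sqNorm (R k)) :=
    (Finset.abs_sum_le_sum_abs _ _).trans
      (Finset.sum_le_sum fun k _ => abs_re_cdot_conj_le (U.coeff k) (R k))
  have h2 := Real.sum_mul_le_sqrt_mul_sqrt O (fun k => Real.sqrt (sqNorm (U.coeff k)))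
    (fun k => Real.sqrt (sqNorm (R k)))
  have h3 : ∑ k ∈ O, Real.sqrt (sqNorm (U.coeff k)) ^ 2 = 2 * truncEnergy U O := by
    unfold truncEnergy
    rw [Finset.mul_sum]
    exact Finset.sum_congr rfl fun k _ => by rw [Real.sq_sqrt (sqNorm_nonneg _), sqNorm_coeff]
  have h4 : ∑ k ∈ O, Real.sqrt (sqNorm (R k)) ^ 2 = sqNormOn R O := by
    unfold sqNormOn
    exact Finset.sum_congr rfl fun k _ => Real.sq_sqrt (sqNorm_nonneg _)
  rw [h3, h4] at h2
  exact h1.trans h2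

/-- **`|Π| ≤ √(2E_O) √(L_O)`**: the flux into the out-band is at most the out-band velocity norm times
the out-band Lamb norm. -/
theorem abs_shellTransfer_le_lamb (I O : Finset (Fin 3 → ℤ)) (h : Disjoint I O)
    (hU : ∀ p ∉ I ∪ O, U.coeff p = 0) :
    |shellTransfer U O I| ≤
      Real.sqrt (2 * truncEnergy U O) * Real.sqrt (sqNormOn (rotational U (I ∪ O)) O) := by
  rw [shellTransfer_eq_lambWork U I O h hU]
  exact abs_work_le U _ O

/-- The GEOMETRIC Lamb efficiency of the split: `e_geom = |Π| / (√(2E_O) · √L_O)`. -/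
def galerkinLambEfficiency (I O : Finset (Fin 3 → ℤ)) : ℝ :=
  |shellTransfer U O I| /
    (Real.sqrt (2 * truncEnergy U O) * Real.sqrt (sqNormOn (rotational U (I ∪ O)) O))

/-- **`e_geom ≤ 1`** (and `= 0` by Lean's `x / 0 = 0` when the out-band velocity or Lamb energy vanishes). -/
theorem galerkinLambEfficiency_le_one (I O : Finset (Fin 3 → ℤ)) (h : Disjoint I O)
    (hU : ∀ p ∉ I ∪ O, U.coeff p = 0) : galerkinLambEfficiency U I O ≤ 1 := by
  unfold galerkinLambEfficiency
  have hden : 0 ≤ Real.sqrt (2 * truncEnergy U O) * Real.sqrt (sqNormOn (rotational U (I ∪ O)) O) :=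
    by positivity
  rcases hden.eq_or_lt with h0 | h0
  · rw [← h0, div_zero]; exact zero_le_one
  · exact (div_le_one h0).2 (abs_shellTransfer_le_lamb U I O h hU)

/-! ## 3. Frisch (2.48) on the truncation with the flux written as Lamb work -/

/-- Along a Galerkin solution on `I ∪ O` whose coefficients at time `t` are supported in `I ∪ O`:
`dE_O/dt = -2ν Z_O + Σ_{k∈O} Re(conj û · (u×ω)^_S) + ε_in,O`. -/
theorem hasDerivAt_outsideEnergy_lambWork {Uc : ℝ → FourierVelocity} {I O : Finset (Fin 3 → ℤ)}
    (h : Disjoint I O) {ν : ℝ} {c : ℝ → (Fin 3 → ℤ) → ℂ} {f : ℝ → (Fin 3 → ℤ) → Fin 3 → ℂ}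
    (hG : IsGalerkinSolution Uc (I ∪ O) ν c f) (t : ℝ) (hsupp : ∀ p ∉ I ∪ O, (Uc t).coeff p = 0) :
    HasDerivAt (fun s => truncEnergy (Uc s) O)
      (-(2 * ν) * truncEnstrophy (Uc t) O + work (Uc t) (rotational (Uc t) (I ∪ O)) O
        + injectionRate (Uc t) (f t) O) t := by
  have h1 := hasDerivAt_outsideEnergy_galerkin h hG t
  rw [shellTransfer_eq_lambWork (Uc t) I O h hsupp] at h1
  exact h1

/-- Unforced Euler/NS truncation (`f = 0`): the out-band energy can grow only through Lamb work, at rate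
`≤ √(2E_O) √L_O`; in particular `d√(2E_O)/dt ≤ √L_O` wherever `E_O > 0` (informal corollary). -/
theorem outsideEnergy_deriv_le {Uc : ℝ → FourierVelocity} {I O : Finset (Fin 3 → ℤ)}
    (h : Disjoint I O) {ν : ℝ} (hν : 0 ≤ ν) {c : ℝ → (Fin 3 → ℤ) → ℂ} {f : ℝ → (Fin 3 → ℤ) → Fin 3 → ℂ}
    (hG : IsGalerkinSolution Uc (I ∪ O) ν c f) (t : ℝ) (hsupp : ∀ p ∉ I ∪ O, (Uc t).coeff p = 0)
    (hf : injectionRate (Uc t) (f t) O = 0) :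
    ∃ D : ℝ, HasDerivAt (fun s => truncEnergy (Uc s) O) D t ∧
      D ≤ Real.sqrt (2 * truncEnergy (Uc t) O) * Real.sqrt (sqNormOn (rotational (Uc t) (I ∪ O)) O) := by
  refine ⟨_, hasDerivAt_outsideEnergy_lambWork h hG t hsupp, ?_⟩
  rw [hf, add_zero]
  have hZ : 0 ≤ truncEnstrophy (Uc t) O := truncEnstrophy_nonneg _ _
  have hW := (abs_le.1 (abs_work_le (Uc t) (rotational (Uc t) (I ∪ O)) O)).2
  nlinarith


end Summit.NavierStokesRegularity.FluidComputer.LambCeiling.Galerkin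

end
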